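import Mathlib
import HarnessLib
import Summits.Ventures.LatticeQCDFlow.Scoring.SplitChainDependsOn
import Summits.Ventures.LatticeQCDFlow.Scoring.SplitChainGaps

/-!
# The number of regenerations in `n` steps: `E[(K_n − e n)²] = n e (1 − e)`, `E|K_n − e n| ≤ √n`,
# and the residual life of the current tour is geometric — from any start

HONEST FRAMING: exact (Metropolis-corrected) sampling algorithms for lattice gauge theory;
figures of merit are autocorrelation/cost numbers at stated couplings and volumes; no
continuum-physics claim.

Venture `LatticeQCDFlow` (cell pub-lqcd), topic `Scoring`; FANOUT row 8 (`s0-cpn-nemc`, GEN-18).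
NEW WORK of the cell, not a published result; no definition is introduced.  Notation of
`Scoring/SplitChainTours.lean`: the split chain `P̂` of `κ(x, ·) ≥ ε ν` from ANY initial law, coin
indicators `c_t = 1{coin_t = heads}`, head count `K_n = Σ_{s<n} c_{s+1}` (= number of regenerations,
i.e. of tours started, by time `n`), `e = ε.toReal`.  Bookkeeping for the Markov-chain CLT of
`Scoring/SplitChainTimeAverageCLT.lean`, where the time average over `n` steps is compared with the
sum of the first `⌊e n⌋` tours: (i) the centred coins `c_{s+1} − e` are orthogonal with variance
`e(1 − e)` given any past (`Scoring/SplitChainDependsOn.splitChain_coin_dependsOn`), so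
`E[(K_n − e n)²] = n e(1 − e) ≤ n/4` and `E|K_n − e n| ≤ √n`; (ii) the probability that the
`j` coins `b+1, …, b+j` are all tails is exactly `(1 − e)^j` (`Scoring/SplitChainGaps.splitChain_tailsRun`),
so the residual life of the tour in progress at any time has a geometric tail, uniformly in the time
and in the initial law.  Printed counterpart NAMED ONLY: elementary renewal bookkeeping
(Feller vol. I ch. XIII) — nothing is cited as a fact.

## Content (`0 ≤ ε < 1`... precisely `ε < 1`; any initial law)

* `splitChain_coin_mean`, `splitChain_centredCoin_orthogonal`, `splitChain_centredCoin_sq` — first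
  and second moments of the coins given the past;
* **`splitChain_headCount_sq_dev`** — `∫ (K_n − e n)² dP̂ = n e (1 − e)`;
* **`splitChain_headCount_abs_dev_le`** — `∫ |K_n − e n| dP̂ ≤ √n`;
* **`splitChain_tailsRun_measureReal`** — `P̂ {coins b+1, …, b+j all tails} = (1 − e)^j`.

NOT CLAIMED: exponential (Chernoff) concentration of `K_n`; anything about a concrete sampler.
-/

noncomputable section

namespace Summit.Ventures.LatticeQCDFlow.Scoring

open MeasureTheory ProbabilityTheory Filter Finset Preorder Literature.Probability.MarkovChains
open scoped ENNReal

variable {Ω : Type*} [MeasurableSpace Ω]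

section Coins

variable {κ : Kernel Ω Ω} [IsMarkovKernel κ] {ν : Measure Ω} [IsProbabilityMeasure ν] {ε : ℝ≥0∞}
  {hmin : ∀ x {B : Set Ω}, MeasurableSet B → ε * ν B ≤ κ x B}
  (κs : Kernel (Ω × Bool) (Ω × Bool)) [IsMarkovKernel κs]
  (μs : Measure (Ω × Bool)) [IsProbabilityMeasure μs]

/-- **Mean of a coin**: `E[c_{b+1}] = e` from any start. -/
theorem splitChain_coin_mean (hε : ε < 1)
    (hκs : ∀ p, κs p = (ε • ν).map (fun y : Ω => (y, true))
      + ((1 - ε) • Doeblin.residualKernel κ ν ε hmin p.1).map (fun y : Ω => (y, false)))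
    (b : ℕ) :
    ∫ x, (if (x (b + 1)).2 then (1 : ℝ) else 0)
        ∂(Kernel.trajMeasure (X := fun _ : ℕ => Ω × Bool) μs
          (fun n : ℕ => κs.comap (fun h : (i : ↥(Finset.Iic n)) → Ω × Bool =>
            h ⟨n, Finset.mem_Iic.2 le_rfl⟩) (measurable_pi_apply _))) = ε.toReal := by
  have h := splitChain_coin_dependsOn κs μs (κ := κ) (ν := ν) (hmin := hmin) hε hκs b
    (G := fun _ => (1 : ℝ)) measurable_const (fun _ _ _ => rfl) (CG := 1) (fun _ => by simp)
  simp only [one_mul, integral_const, probReal_univ, one_smul, mul_one] at h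
  exact h

/-- **Centred coins are orthogonal given the past**: for `s < s'`,
`E[(c_{s+1} − e)(c_{s'+1} − e)] = 0`. -/
theorem splitChain_centredCoin_orthogonal (hε : ε < 1)
    (hκs : ∀ p, κs p = (ε • ν).map (fun y : Ω => (y, true))
      + ((1 - ε) • Doeblin.residualKernel κ ν ε hmin p.1).map (fun y : Ω => (y, false)))
    {s s' : ℕ} (hss' : s < s') :
    ∫ x, ((if (x (s + 1)).2 then (1 : ℝ) else 0) - ε.toReal)
          * ((if (x (s' + 1)).2 then (1 : ℝ) else 0) - ε.toReal)
        ∂(Kernel.trajMeasure (X := fun _ : ℕ => Ω × Bool) μs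
          (fun n : ℕ => κs.comap (fun h : (i : ↥(Finset.Iic n)) → Ω × Bool =>
            h ⟨n, Finset.mem_Iic.2 le_rfl⟩) (measurable_pi_apply _))) = 0 := by
  set P := Kernel.trajMeasure (X := fun _ : ℕ => Ω × Bool) μs
      (fun n : ℕ => κs.comap (fun h : (i : ↥(Finset.Iic n)) → Ω × Bool =>
        h ⟨n, Finset.mem_Iic.2 le_rfl⟩) (measurable_pi_apply _)) with hP
  -- the earlier centred coin is a bounded functional of the path up to `s'`
  have hGm : Measurable fun x : ℕ → Ω × Bool => (if (x (s + 1)).2 then (1 : ℝ) else 0) - ε.toReal :=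
    (measurable_coinHeads (s + 1)).sub_const _
  have hGd : DependsOn (fun x : ℕ → Ω × Bool => (if (x (s + 1)).2 then (1 : ℝ) else 0) - ε.toReal)
      (Set.Iic s') := fun x y hxy => by
    show (if (x (s + 1)).2 then (1 : ℝ) else 0) - ε.toReal = (if (y (s + 1)).2 then (1 : ℝ) else 0) - _
    rw [hxy (s + 1) (Set.mem_Iic.2 (Nat.succ_le_of_lt hss'))]
  have he1 : ε.toReal ≤ 1 := ENNReal.toReal_le_of_le_ofReal zero_le_one
    (by rw [ENNReal.ofReal_one]; exact hε.le)
  have hGC : ∀ x : ℕ → Ω × Bool, |(if (x (s + 1)).2 then (1 : ℝ) else 0) - ε.toReal| ≤ 1 :=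
    fun x => by
      have h0 := ENNReal.toReal_nonneg (a := ε)
      split_ifs <;> rw [abs_le] <;> constructor <;> linarith
  have hGi : Integrable (fun x : ℕ → Ω × Bool =>
      (if (x (s + 1)).2 then (1 : ℝ) else 0) - ε.toReal) P := integrable_of_bounded P hGm hGC
  have h := splitChain_coin_dependsOn κs μs (κ := κ) (ν := ν) (hmin := hmin) hε hκs s' hGm hGd hGC
  rw [← hP] at h
  have hsplit : ∀ x : ℕ → Ω × Bool, ((if (x (s + 1)).2 then (1 : ℝ) else 0) - ε.toReal)
      * ((if (x (s' + 1)).2 then (1 : ℝ) else 0) - ε.toReal)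
      = ((if (x (s + 1)).2 then (1 : ℝ) else 0) - ε.toReal) * (if (x (s' + 1)).2 then (1 : ℝ) else 0)
        - ε.toReal * ((if (x (s + 1)).2 then (1 : ℝ) else 0) - ε.toReal) := fun x => by ring
  have hI1 : Integrable (fun x : ℕ → Ω × Bool => ((if (x (s + 1)).2 then (1 : ℝ) else 0) - ε.toReal)
      * (if (x (s' + 1)).2 then (1 : ℝ) else 0)) P :=
    integrable_of_bounded P (hGm.mul (measurable_coinHeads (s' + 1))) (C := 1 * 1) fun x => by
      rw [abs_mul]
      exact mul_le_mul (hGC x) (by split_ifs <;> simp) (abs_nonneg _) zero_le_one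
  simp_rw [hsplit]
  rw [integral_sub hI1 (hGi.const_mul _), integral_const_mul, h, sub_self]

/-- **Variance of a coin**: `E[(c_{s+1} − e)²] = e(1 − e)`. -/
theorem splitChain_centredCoin_sq (hε : ε < 1)
    (hκs : ∀ p, κs p = (ε • ν).map (fun y : Ω => (y, true))
      + ((1 - ε) • Doeblin.residualKernel κ ν ε hmin p.1).map (fun y : Ω => (y, false)))
    (s : ℕ) :
    ∫ x, ((if (x (s + 1)).2 then (1 : ℝ) else 0) - ε.toReal) ^ 2
        ∂(Kernel.trajMeasure (X := fun _ : ℕ => Ω × Bool) μs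
          (fun n : ℕ => κs.comap (fun h : (i : ↥(Finset.Iic n)) → Ω × Bool =>
            h ⟨n, Finset.mem_Iic.2 le_rfl⟩) (measurable_pi_apply _)))
      = ε.toReal * (1 - ε.toReal) := by
  set P := Kernel.trajMeasure (X := fun _ : ℕ => Ω × Bool) μs
      (fun n : ℕ => κs.comap (fun h : (i : ↥(Finset.Iic n)) → Ω × Bool =>
        h ⟨n, Finset.mem_Iic.2 le_rfl⟩) (measurable_pi_apply _)) with hP
  -- `(c − e)² = (1 − 2e) c + e²` since `c² = c`
  have hsq : ∀ x : ℕ → Ω × Bool, ((if (x (s + 1)).2 then (1 : ℝ) else 0) - ε.toReal) ^ 2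
      = (1 - 2 * ε.toReal) * (if (x (s + 1)).2 then (1 : ℝ) else 0) + ε.toReal ^ 2 := fun x => by
    split_ifs <;> ring
  simp_rw [hsq]
  have hc := splitChain_coin_mean κs μs (κ := κ) (ν := ν) (hmin := hmin) hε hκs s
  rw [← hP] at hc
  rw [integral_add ((integrable_of_bounded P (measurable_coinHeads (s + 1)) (C := 1)
      (fun x => by split_ifs <;> simp)).const_mul _) (integrable_const _), integral_const_mul, hc,
    integral_const, probReal_univ, one_smul]
  ring

/-- **THE NUMBER OF REGENERATIONS CONCENTRATES**: `∫ (K_n − e n)² dP̂ = n e (1 − e)` from any start,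
with `K_n = Σ_{s<n} c_{s+1}` written as a real sum. -/
theorem splitChain_headCount_sq_dev (hε : ε < 1)
    (hκs : ∀ p, κs p = (ε • ν).map (fun y : Ω => (y, true))
      + ((1 - ε) • Doeblin.residualKernel κ ν ε hmin p.1).map (fun y : Ω => (y, false)))
    (n : ℕ) :
    ∫ x, ((∑ s ∈ Finset.range n, (if (x (s + 1)).2 then (1 : ℝ) else 0)) - ε.toReal * n) ^ 2
        ∂(Kernel.trajMeasure (X := fun _ : ℕ => Ω × Bool) μs
          (fun n : ℕ => κs.comap (fun h : (i : ↥(Finset.Iic n)) → Ω × Bool =>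
            h ⟨n, Finset.mem_Iic.2 le_rfl⟩) (measurable_pi_apply _)))
      = n * (ε.toReal * (1 - ε.toReal)) := by
  set P := Kernel.trajMeasure (X := fun _ : ℕ => Ω × Bool) μs
      (fun n : ℕ => κs.comap (fun h : (i : ↥(Finset.Iic n)) → Ω × Bool =>
        h ⟨n, Finset.mem_Iic.2 le_rfl⟩) (measurable_pi_apply _)) with hP
  set ξ : ℕ → (ℕ → Ω × Bool) → ℝ := fun s x => (if (x (s + 1)).2 then (1 : ℝ) else 0) - ε.toReal
    with hξ
  have he1 : ε.toReal ≤ 1 := ENNReal.toReal_le_of_le_ofReal zero_le_one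
    (by rw [ENNReal.ofReal_one]; exact hε.le)
  have hξm : ∀ s, Measurable (ξ s) := fun s => (measurable_coinHeads (s + 1)).sub_const _
  have hξC : ∀ s x, |ξ s x| ≤ 1 := fun s x => by
    have h0 := ENNReal.toReal_nonneg (a := ε)
    simp only [hξ]
    split_ifs <;> rw [abs_le] <;> constructor <;> linarith
  have hξξi : ∀ s s', Integrable (fun x => ξ s x * ξ s' x) P := fun s s' =>
    integrable_of_bounded P ((hξm s).mul (hξm s')) (C := 1 * 1) fun x => by
      rw [abs_mul]; exact mul_le_mul (hξC s x) (hξC s' x) (abs_nonneg _) zero_le_one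
  -- `K_n − e n = Σ_{s<n} ξ_s`
  have hdev : ∀ x : ℕ → Ω × Bool, (∑ s ∈ Finset.range n, (if (x (s + 1)).2 then (1 : ℝ) else 0))
      - ε.toReal * n = ∑ s ∈ Finset.range n, ξ s x := fun x => by
    simp only [hξ, Finset.sum_sub_distrib, Finset.sum_const, Finset.card_range, nsmul_eq_mul]
    ring
  -- diagonal and off-diagonal second moments
  have hdiag : ∀ s, ∫ x, ξ s x * ξ s x ∂P = ε.toReal * (1 - ε.toReal) := fun s => by
    have h2 := splitChain_centredCoin_sq κs μs (κ := κ) (ν := ν) (hmin := hmin) hε hκs s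
    rw [← hP] at h2
    refine Eq.trans (integral_congr_ae (ae_of_all _ fun x => ?_)) h2
    simp only [hξ]
    ring
  have hoff : ∀ s s', s ≠ s' → ∫ x, ξ s x * ξ s' x ∂P = 0 := fun s s' h => by
    rcases Nat.lt_or_gt_of_ne h with hlt | hgt
    · have h2 := splitChain_centredCoin_orthogonal κs μs (κ := κ) (ν := ν) (hmin := hmin) hε hκs hlt
      rw [← hP] at h2
      exact h2
    · have h2 := splitChain_centredCoin_orthogonal κs μs (κ := κ) (ν := ν) (hmin := hmin) hε hκs hgt
      rw [← hP] at h2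
      refine Eq.trans (integral_congr_ae (ae_of_all _ fun x => ?_)) h2
      simp only [hξ]
      ring
  calc ∫ x, ((∑ s ∈ Finset.range n, (if (x (s + 1)).2 then (1 : ℝ) else 0)) - ε.toReal * n) ^ 2 ∂P
      = ∫ x, ∑ s ∈ Finset.range n, ∑ s' ∈ Finset.range n, ξ s x * ξ s' x ∂P :=
        integral_congr_ae (ae_of_all _ fun x => by
          beta_reduce
          rw [hdev, sq, Finset.sum_mul_sum])
    _ = ∑ s ∈ Finset.range n, ∑ s' ∈ Finset.range n, ∫ x, ξ s x * ξ s' x ∂P := by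
        rw [integral_finsetSum _ fun s _ => integrable_finsetSum _ fun s' _ => hξξi s s']
        exact Finset.sum_congr rfl fun s _ => integral_finsetSum _ fun s' _ => hξξi s s'
    _ = ∑ s ∈ Finset.range n, ε.toReal * (1 - ε.toReal) := by
        refine Finset.sum_congr rfl fun s hs => ?_
        rw [Finset.sum_eq_single_of_mem s hs fun s' _ hne => hoff s s' hne.symm]
        exact hdiag s
    _ = n * (ε.toReal * (1 - ε.toReal)) := by
        rw [Finset.sum_const, Finset.card_range, nsmul_eq_mul]

/-- **`E|K_n − e n| ≤ √n`** from any start (from `|y| ≤ √n/2 + y²/(2√n)` and `e(1−e) ≤ 1/4`). -/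
theorem splitChain_headCount_abs_dev_le (hε : ε < 1)
    (hκs : ∀ p, κs p = (ε • ν).map (fun y : Ω => (y, true))
      + ((1 - ε) • Doeblin.residualKernel κ ν ε hmin p.1).map (fun y : Ω => (y, false)))
    (n : ℕ) :
    ∫ x, |(∑ s ∈ Finset.range n, (if (x (s + 1)).2 then (1 : ℝ) else 0)) - ε.toReal * n|
        ∂(Kernel.trajMeasure (X := fun _ : ℕ => Ω × Bool) μs
          (fun n : ℕ => κs.comap (fun h : (i : ↥(Finset.Iic n)) → Ω × Bool =>
            h ⟨n, Finset.mem_Iic.2 le_rfl⟩) (measurable_pi_apply _)))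
      ≤ Real.sqrt n := by
  set P := Kernel.trajMeasure (X := fun _ : ℕ => Ω × Bool) μs
      (fun n : ℕ => κs.comap (fun h : (i : ↥(Finset.Iic n)) → Ω × Bool =>
        h ⟨n, Finset.mem_Iic.2 le_rfl⟩) (measurable_pi_apply _)) with hP
  have he0 : 0 ≤ ε.toReal := ENNReal.toReal_nonneg
  have he1 : ε.toReal ≤ 1 := ENNReal.toReal_le_of_le_ofReal zero_le_one
    (by rw [ENNReal.ofReal_one]; exact hε.le)
  have hDm : Measurable fun x : ℕ → Ω × Bool =>
      (∑ s ∈ Finset.range n, (if (x (s + 1)).2 then (1 : ℝ) else 0)) - ε.toReal * n :=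
    (Finset.measurable_sum _ fun s _ => measurable_coinHeads (s + 1)).sub_const _
  have hDC : ∀ x : ℕ → Ω × Bool,
      |(∑ s ∈ Finset.range n, (if (x (s + 1)).2 then (1 : ℝ) else 0)) - ε.toReal * n| ≤ n + n := by
    intro x
    have h1 : |∑ s ∈ Finset.range n, (if (x (s + 1)).2 then (1 : ℝ) else 0)| ≤ n := by
      refine (Finset.abs_sum_le_sum_abs _ _).trans ?_
      calc ∑ s ∈ Finset.range n, |(if (x (s + 1)).2 then (1 : ℝ) else 0)|
          ≤ ∑ s ∈ Finset.range n, (1 : ℝ) := Finset.sum_le_sum fun s _ => by split_ifs <;> simp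
        _ = n := by simp
    have h2 : |ε.toReal * n| ≤ n := by
      rw [abs_of_nonneg (by positivity)]
      exact mul_le_of_le_one_left (Nat.cast_nonneg n) he1
    exact (abs_sub _ _).trans (add_le_add h1 h2)
  rcases Nat.eq_zero_or_pos n with hn | hn
  · subst hn
    simp only [Finset.range_zero, Finset.sum_empty, Nat.cast_zero, mul_zero, sub_zero, abs_zero,
      integral_zero, Real.sqrt_zero, le_refl]
  have hn0 : (0 : ℝ) < n := Nat.cast_pos.2 hn
  have hsq0 : 0 < Real.sqrt n := Real.sqrt_pos.2 hn0
  have hsq : Real.sqrt n ^ 2 = n := Real.sq_sqrt hn0.le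
  -- pointwise AM–GM: `|y| ≤ √n/2 + y²/(2√n)`
  have hpt : ∀ y : ℝ, |y| ≤ Real.sqrt n / 2 + y ^ 2 / (2 * Real.sqrt n) := by
    intro y
    have h2 : 2 * Real.sqrt n * |y| ≤ Real.sqrt n ^ 2 + y ^ 2 := by
      nlinarith [sq_nonneg (|y| - Real.sqrt n), sq_abs y]
    calc |y| = 2 * Real.sqrt n * |y| / (2 * Real.sqrt n) := by field_simp
      _ ≤ (Real.sqrt n ^ 2 + y ^ 2) / (2 * Real.sqrt n) :=
          div_le_div_of_nonneg_right h2 (by positivity)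
      _ = Real.sqrt n / 2 + y ^ 2 / (2 * Real.sqrt n) := by
          field_simp
  have hsqI : Integrable (fun x : ℕ → Ω × Bool =>
      ((∑ s ∈ Finset.range n, (if (x (s + 1)).2 then (1 : ℝ) else 0)) - ε.toReal * n) ^ 2) P :=
    integrable_of_bounded P (hDm.pow_const 2) (C := (n + n) ^ 2) fun x => by
      rw [abs_pow]; exact pow_le_pow_left₀ (abs_nonneg _) (hDC x) 2
  have hstep1 : ∫ x, |(∑ s ∈ Finset.range n, (if (x (s + 1)).2 then (1 : ℝ) else 0)) - ε.toReal * n| ∂P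
      ≤ ∫ x, (Real.sqrt n / 2 + ((∑ s ∈ Finset.range n, (if (x (s + 1)).2 then (1 : ℝ) else 0))
          - ε.toReal * n) ^ 2 / (2 * Real.sqrt n)) ∂P :=
    integral_mono (integrable_of_bounded P hDm.abs (C := n + n) fun x => by
      rw [abs_abs]; exact hDC x) ((integrable_const _).add (hsqI.div_const _)) fun x => hpt _
  have hstep2 : ∫ x, (Real.sqrt n / 2 + ((∑ s ∈ Finset.range n, (if (x (s + 1)).2 then (1 : ℝ) else 0))
          - ε.toReal * n) ^ 2 / (2 * Real.sqrt n)) ∂P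
      = Real.sqrt n / 2 + n * (ε.toReal * (1 - ε.toReal)) / (2 * Real.sqrt n) := by
    rw [integral_add (integrable_const _) (hsqI.div_const _), integral_const, probReal_univ,
      one_smul, integral_div]
    congr 2
    exact splitChain_headCount_sq_dev κs μs (κ := κ) (ν := ν) (hmin := hmin) hε hκs n
  have hvar : ε.toReal * (1 - ε.toReal) ≤ 1 / 4 := by
    nlinarith [sq_nonneg (2 * ε.toReal - 1)]
  have hstep3 : n * (ε.toReal * (1 - ε.toReal)) / (2 * Real.sqrt n) ≤ n * (1 / 4) / (2 * Real.sqrt n) :=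
    div_le_div_of_nonneg_right (mul_le_mul_of_nonneg_left hvar hn0.le) (by positivity)
  have hstep4 : (n : ℝ) * (1 / 4) / (2 * Real.sqrt n) = Real.sqrt n / 8 := by
    have h : Real.sqrt n / 8 * (2 * Real.sqrt n) = n * (1 / 4) := by
      rw [show Real.sqrt n / 8 * (2 * Real.sqrt n) = Real.sqrt n ^ 2 / 4 by ring, hsq]
      ring
    rw [div_eq_iff (by positivity)]
    exact h.symm
  calc ∫ x, |(∑ s ∈ Finset.range n, (if (x (s + 1)).2 then (1 : ℝ) else 0)) - ε.toReal * n| ∂P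
      ≤ Real.sqrt n / 2 + n * (ε.toReal * (1 - ε.toReal)) / (2 * Real.sqrt n) :=
        hstep1.trans_eq hstep2
    _ ≤ Real.sqrt n / 2 + Real.sqrt n / 8 := by rw [← hstep4]; linarith
    _ ≤ Real.sqrt n := by linarith

/-- **A run of `j` tails has probability exactly `(1 − e)^j`**: for every `b`,
`P̂ {x | ∀ i < j, coin_{b+i+1} = tails} = (1 − e)^j`, from any start. -/
theorem splitChain_tailsRun_measureReal (hε : ε < 1)
    (hκs : ∀ p, κs p = (ε • ν).map (fun y : Ω => (y, true))
      + ((1 - ε) • Doeblin.residualKernel κ ν ε hmin p.1).map (fun y : Ω => (y, false)))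
    (b j : ℕ) :
    (Kernel.trajMeasure (X := fun _ : ℕ => Ω × Bool) μs
        (fun n : ℕ => κs.comap (fun h : (i : ↥(Finset.Iic n)) → Ω × Bool =>
          h ⟨n, Finset.mem_Iic.2 le_rfl⟩) (measurable_pi_apply _))).real
      {x | ∀ i < j, (x (b + i + 1)).2 = false} = (1 - ε.toReal) ^ j := by
  set P := Kernel.trajMeasure (X := fun _ : ℕ => Ω × Bool) μs
      (fun n : ℕ => κs.comap (fun h : (i : ↥(Finset.Iic n)) → Ω × Bool =>
        h ⟨n, Finset.mem_Iic.2 le_rfl⟩) (measurable_pi_apply _)) with hP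
  have h := splitChain_tailsRun κs μs (κ := κ) (ν := ν) (hmin := hmin) hε hκs b
    (G := fun _ => (1 : ℝ)) measurable_const (fun _ _ _ => rfl) (CG := 1) (fun _ => by simp) j
  rw [← hP] at h
  simp only [one_mul, integral_const, probReal_univ, one_smul, mul_one] at h
  have hS : MeasurableSet {x : ℕ → Ω × Bool | ∀ i < j, (x (b + i + 1)).2 = false} := by
    have : {x : ℕ → Ω × Bool | ∀ i < j, (x (b + i + 1)).2 = false}
        = ⋂ i ∈ Finset.range j, {x | (x (b + i + 1)).2 = false} := by
      ext x; simp [Set.mem_iInter, Finset.mem_range]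
    rw [this]
    exact Finset.measurableSet_biInter _ fun i _ =>
      (measurable_snd.comp (measurable_pi_apply (b + i + 1))) (measurableSet_singleton false)
  rw [← h, ← integral_indicator_one hS]
  refine integral_congr_ae (ae_of_all _ fun x => ?_)
  simp only [Set.indicator_apply, Set.mem_setOf_eq, Pi.one_apply]
  by_cases hx : ∀ i < j, (x (b + i + 1)).2 = false
  · rw [if_pos hx]
    exact (Finset.prod_eq_one fun i hi => by rw [hx i (Finset.mem_range.1 hi)]; simp).symm
  · rw [if_neg hx]
    push Not at hx
    obtain ⟨i, hi, hxi⟩ := hx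
    symm
    have hxt : (x (b + i + 1)).2 = true := by simpa using hxi
    exact Finset.prod_eq_zero (Finset.mem_range.2 hi) (by simp [hxt])

end Coins

end Summit.Ventures.LatticeQCDFlow.Scoring

end
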